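import Mathlib
import HarnessLib

/-!
# CONJECTURE R^prod fails for three factors: an explicit negative minor

Support file for the Sahi / Conjecture-P programme of route `PercNearOneGluingNoHeavy`
(`--supports stmt-CriticalPhenomena-4575`, prover prim-l12-p5 gen 52; note
`prim-l12-p5/REFUTATION-RPROD3-g52.md`).  No definitions, no named facts, no sorries.

CONJECTURE R^prod (prim-l12-p5 gen 48, memo `PROOF-DIFFERENCE-HURWITZ-g48.md` (3.3)) asserted: for
`Θ_β = β D + N̂` (`D(k,k-1) = k`, `N̂(k,k) = k`), every ordered product
`W = (Θ_{β₁} + r₁)(Θ_{β₂} + r₂)⋯(Θ_{β_m} + r_m)` with `β_j > 0`, `r₁ ≥ 0` and gaps `r_{j+1} - r_j ≥ 1`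
has a totally nonnegative operator Hurwitz matrix — the kernel on the doubled index `t` with rows
`t = 2k ↦ W(k,·)` and `t = 2k+1 ↦ C(k,·)`, `C(k,l) = W(k+1,l) - W(k,l-1)`.  The case `m = 2` is the
tree's `TwoFactorHurwitz.twoFactor_hurwitz_tn`.

**THEOREM (`threeFactor_minor_neg`, `threeFactor_not_tn`).**  The case `m = 3` is FALSE: for
`(β₁, β₂, β₃) = (10, 10, 9)` and `(r₁, r₂, r₃) = (3/2, 3, 4)` (gaps `3/2` and `1`) the bands of
`W = (Θ_{β₁} + r₁)(Θ_{β₂} + r₂)(Θ_{β₃} + r₃)` are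
`κ₀(k) = (k+r₁)(k+r₂)(k+r₃)`,
`κ₁(k) = k(β₁(k-1+r₂)(k-1+r₃) + β₂(k+r₁)(k-1+r₃) + β₃(k+r₁)(k+r₂))`,
`κ₂(k) = k(k-1)(β₁β₂(k-2+r₃) + β₁β₃(k-1+r₂) + β₂β₃(k+r₁))`, `κ₃(k) = β₁β₂β₃k(k-1)(k-2)`,
and the `6 × 6` minor of the doubled kernel with rows `t = 5,…,10` (i.e. `C(2,·), W(3,·), C(3,·),
W(4,·), C(4,·), W(5,·)`) and columns `0,…,5` is the integer matrix
`[[5400, 5980, 1374, 84, 0, 0], [5400, 8130, 2439, 189, 0, 0], [0, 16200, 11490, 2167, 119, 0],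
 [0, 21600, 19620, 4606, 308, 0], [0, 0, 32400, 18680, 3134, 160], [0, 0, 54000, 38300, 7740, 468]]`
whose determinant is `-662256000000 < 0`.  (All minors of order `≤ 5` of this product are `≥ 0`:
the failure sits in the deepest pivot `P₆` of the block elimination, on the thin set
"last gap `= 1`, first gap in `(1,2)`, `β₁ = β₂ ≈ β₃`" adjacent to the neutral family; see the note.)
-/

namespace Summit.CriticalPhenomena.PercolationContinuityZ3.Theorems

namespace ThreeFactorHurwitz

open Finset Matrix

/-- The witness minor as an explicit matrix over `ℝ`. -/
theorem witness_det :
    (!![(5400:ℝ), 5980, 1374, 84, 0, 0;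
        5400, 8130, 2439, 189, 0, 0;
        0, 16200, 11490, 2167, 119, 0;
        0, 21600, 19620, 4606, 308, 0;
        0, 0, 32400, 18680, 3134, 160;
        0, 0, 54000, 38300, 7740, 468]).det = -662256000000 := by
  simp [Matrix.det_succ_row_zero, Fin.sum_univ_succ, Matrix.submatrix_apply, Fin.succAbove]
  norm_num

/-- **A negative `6 × 6` minor of the three-factor operator Hurwitz matrix.**  With the bands
`κ₀,…,κ₃` of `W = (Θ_{10} + 3/2)(Θ_{10} + 3)(Θ_9 + 4)` (gaps `3/2 ≥ 1` and `1 ≥ 1`, `r₁ = 3/2 > 0`),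
the doubled kernel (rows `2k ↦ W(k,·)`, `2k+1 ↦ C(k,·) = W(k+1,·) - W(k,·-1)`) has the minor with
rows `5,…,10` and columns `0,…,5` equal to `-662256000000`. -/
theorem threeFactor_minor_neg (κ₀ κ₁ κ₂ κ₃ : ℕ → ℝ)
    (hκ₀ : ∀ k : ℕ, κ₀ k = ((k : ℝ) + 3 / 2) * ((k : ℝ) + 3) * ((k : ℝ) + 4))
    (hκ₁ : ∀ k : ℕ, κ₁ k = (k : ℝ) * (10 * ((k : ℝ) - 1 + 3) * ((k : ℝ) - 1 + 4)
      + 10 * ((k : ℝ) + 3 / 2) * ((k : ℝ) - 1 + 4) + 9 * ((k : ℝ) + 3 / 2) * ((k : ℝ) + 3)))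
    (hκ₂ : ∀ k : ℕ, κ₂ k = (k : ℝ) * ((k : ℝ) - 1) * (10 * 10 * ((k : ℝ) - 2 + 4)
      + 10 * 9 * ((k : ℝ) - 1 + 3) + 10 * 9 * ((k : ℝ) + 3 / 2)))
    (hκ₃ : ∀ k : ℕ, κ₃ k = 10 * 10 * 9 * ((k : ℝ) * ((k : ℝ) - 1) * ((k : ℝ) - 2))) :
    (Matrix.of fun i j : Fin 6 =>
      if ((i : ℕ) + 5) % 2 = 0 then
        (if (j : ℕ) = ((i : ℕ) + 5) / 2 then κ₀ (((i : ℕ) + 5) / 2)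
          else if (j : ℕ) + 1 = ((i : ℕ) + 5) / 2 then κ₁ (((i : ℕ) + 5) / 2)
          else if (j : ℕ) + 2 = ((i : ℕ) + 5) / 2 then κ₂ (((i : ℕ) + 5) / 2)
          else if (j : ℕ) + 3 = ((i : ℕ) + 5) / 2 then κ₃ (((i : ℕ) + 5) / 2) else 0)
      else
        (if (j : ℕ) = ((i : ℕ) + 5) / 2 + 1 then κ₀ (((i : ℕ) + 5) / 2 + 1) - κ₀ (((i : ℕ) + 5) / 2)
          else if (j : ℕ) = ((i : ℕ) + 5) / 2 then κ₁ (((i : ℕ) + 5) / 2 + 1) - κ₁ (((i : ℕ) + 5) / 2)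
          else if (j : ℕ) + 1 = ((i : ℕ) + 5) / 2 then κ₂ (((i : ℕ) + 5) / 2 + 1) - κ₂ (((i : ℕ) + 5) / 2)
          else if (j : ℕ) + 2 = ((i : ℕ) + 5) / 2 then κ₃ (((i : ℕ) + 5) / 2 + 1) - κ₃ (((i : ℕ) + 5) / 2)
          else 0)).det = -662256000000 := by
  have hM : (Matrix.of fun i j : Fin 6 =>
      if ((i : ℕ) + 5) % 2 = 0 then
        (if (j : ℕ) = ((i : ℕ) + 5) / 2 then κ₀ (((i : ℕ) + 5) / 2)
          else if (j : ℕ) + 1 = ((i : ℕ) + 5) / 2 then κ₁ (((i : ℕ) + 5) / 2)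
          else if (j : ℕ) + 2 = ((i : ℕ) + 5) / 2 then κ₂ (((i : ℕ) + 5) / 2)
          else if (j : ℕ) + 3 = ((i : ℕ) + 5) / 2 then κ₃ (((i : ℕ) + 5) / 2) else 0)
      else
        (if (j : ℕ) = ((i : ℕ) + 5) / 2 + 1 then κ₀ (((i : ℕ) + 5) / 2 + 1) - κ₀ (((i : ℕ) + 5) / 2)
          else if (j : ℕ) = ((i : ℕ) + 5) / 2 then κ₁ (((i : ℕ) + 5) / 2 + 1) - κ₁ (((i : ℕ) + 5) / 2)
          else if (j : ℕ) + 1 = ((i : ℕ) + 5) / 2 then κ₂ (((i : ℕ) + 5) / 2 + 1) - κ₂ (((i : ℕ) + 5) / 2)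
          else if (j : ℕ) + 2 = ((i : ℕ) + 5) / 2 then κ₃ (((i : ℕ) + 5) / 2 + 1) - κ₃ (((i : ℕ) + 5) / 2)
          else 0)) =
      !![(5400:ℝ), 5980, 1374, 84, 0, 0;
        5400, 8130, 2439, 189, 0, 0;
        0, 16200, 11490, 2167, 119, 0;
        0, 21600, 19620, 4606, 308, 0;
        0, 0, 32400, 18680, 3134, 160;
        0, 0, 54000, 38300, 7740, 468] := by
    ext i j
    fin_cases i <;> fin_cases j <;> simp [hκ₀, hκ₁, hκ₂, hκ₃] <;> norm_num
  rw [hM]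
  exact witness_det

/-- **CONJECTURE R^prod is false for `m = 3`.**  The doubled kernel of
`W = (Θ_{10} + 3/2)(Θ_{10} + 3)(Θ_9 + 4)` (all `β_j > 0`, `r₁ = 3/2 > 0`, gaps `3/2` and `1`, both
`≥ 1`) is not totally nonnegative: some minor with strictly increasing row and column indices is
negative (rows `5,…,10`, columns `0,…,5`, value `-662256000000`). -/
theorem threeFactor_not_tn (κ₀ κ₁ κ₂ κ₃ : ℕ → ℝ)
    (hκ₀ : ∀ k : ℕ, κ₀ k = ((k : ℝ) + 3 / 2) * ((k : ℝ) + 3) * ((k : ℝ) + 4))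
    (hκ₁ : ∀ k : ℕ, κ₁ k = (k : ℝ) * (10 * ((k : ℝ) - 1 + 3) * ((k : ℝ) - 1 + 4)
      + 10 * ((k : ℝ) + 3 / 2) * ((k : ℝ) - 1 + 4) + 9 * ((k : ℝ) + 3 / 2) * ((k : ℝ) + 3)))
    (hκ₂ : ∀ k : ℕ, κ₂ k = (k : ℝ) * ((k : ℝ) - 1) * (10 * 10 * ((k : ℝ) - 2 + 4)
      + 10 * 9 * ((k : ℝ) - 1 + 3) + 10 * 9 * ((k : ℝ) + 3 / 2)))
    (hκ₃ : ∀ k : ℕ, κ₃ k = 10 * 10 * 9 * ((k : ℝ) * ((k : ℝ) - 1) * ((k : ℝ) - 2))) :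
    ¬ (∀ {m : ℕ} (r c : Fin m → ℕ), StrictMono r → StrictMono c →
      0 ≤ (Matrix.of fun i j =>
        if r i % 2 = 0 then
          (if c j = r i / 2 then κ₀ (r i / 2)
            else if c j + 1 = r i / 2 then κ₁ (r i / 2)
            else if c j + 2 = r i / 2 then κ₂ (r i / 2)
            else if c j + 3 = r i / 2 then κ₃ (r i / 2) else 0)
        else
          (if c j = r i / 2 + 1 then κ₀ (r i / 2 + 1) - κ₀ (r i / 2)
            else if c j = r i / 2 then κ₁ (r i / 2 + 1) - κ₁ (r i / 2)
            else if c j + 1 = r i / 2 then κ₂ (r i / 2 + 1) - κ₂ (r i / 2)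
            else if c j + 2 = r i / 2 then κ₃ (r i / 2 + 1) - κ₃ (r i / 2)
            else 0)).det) := by
  intro h
  have hr : StrictMono (fun i : Fin 6 => (i : ℕ) + 5) := fun a b hab => by
    simpa using hab
  have hc : StrictMono (fun j : Fin 6 => (j : ℕ)) := fun a b hab => by simpa using hab
  have h6 := h (fun i : Fin 6 => (i : ℕ) + 5) (fun j : Fin 6 => (j : ℕ)) hr hc
  have hval := threeFactor_minor_neg κ₀ κ₁ κ₂ κ₃ hκ₀ hκ₁ hκ₂ hκ₃
  rw [hval] at h6
  norm_num at h6

end ThreeFactorHurwitz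

end Summit.CriticalPhenomena.PercolationContinuityZ3.Theorems
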